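import Literature.NumberTheory.LFunctions.PsiThetaSmall
import Literature.NumberTheory.LFunctions.SchoenfeldThetaLarge
import HarnessLib

/-!
# Nicolas's Lemma 2.4 and (2.18) from the Riemann hypothesis alone (no `θ(x) < x` computation)

Topic: `Literature/NumberTheory/LFunctions`. THEOREMS (everything proved; no new definitions).
Provefact `Literature.NumberTheory.LFunctions.robin_iff`: removal of the only named fact left under
Robin's criterion after `Schoenfeld1976_theta_holds` (`SchoenfeldThetaLarge.lean`), namely the published
computation `PlattTrudgian2016_theta_lt` (`θ(y) < y` for `y ≤ 1.39·10¹⁷`), which enters Nicolas's chain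
only through Case 2 (`2³² ≤ t ≤ 2¹⁰⁰`) of

  Lemma 2.4 (2.12): `ψ(t) − θ(t) ≤ √t + (4/3) t^{1/3}` (`t ≥ 1`),

where Nicolas bounds `θ(√t)`, `θ(t^{1/3})` by `θ(y) < y` (Dusart's table; Platt–Trudgian in the tree,
`NicolasPsiTheta.psi_sub_theta_le_case2`). Under RH this table can be traded for Schoenfeld's bound
`θ(y) ≤ y + √y log² y/(8π)` at the price of the term `t^{1/4} log² t/(32π) ≤ 0.0192 √t` (`t ≥ 2³²`):

* `Lemma24RH.psi_sub_theta_le_case2RH` — under RH, for `t ≥ 2³²`: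
  `ψ(t) − θ(t) ≤ 1.021 √t + (4/3) t^{1/3}`, from `ψ − θ ≤ ψ(√t) + ψ(t^{1/3}) + ψ(t^{1/5})` (Mathlib),
  `ψ(y) − θ(y) ≤ 1.04(√y + y^{1/3} + y^{1/5})` (`SchoenfeldBound.psi_sub_theta_le`) and
  `Schoenfeld1976_theta_holds` at `√t, t^{1/3} ≥ 599`; the excess is
  `≤ 0.01912 √t` (`excess_half_le`, `log² t/t^{1/4}` non-increasing) `+ (0.054 + 1.04·0.27474 − 1/3) t^{1/3}`
  (`excess_third_le`, `rpow_le_mul_third`) `≤ 0.0193 √t`;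
* `Lemma24RH.psi_sub_theta_le` — **under RH, `ψ(x) − θ(x) ≤ 1.021 √x + (4/3) x^{1/3}` for all `x ≥ 1`**
  (Case 1, `x < 2³²`: the tree's kernel computation `psi_sub_theta_le_of_lt_two_pow_32`; Case 3,
  `x ≥ 2¹⁰⁰`: `NicolasPsiTheta.psi_sub_theta_le_case3` with `Schoenfeld1976_theta_holds`);
* `Lemma24RH.cor21_upperRH` — Cor. 2.1 (2.13) with the factor: `J − K ≤ 1.021 F_{1/2} + (4/3) F_{1/3}`;
* `Lemma24RH.logf_lowerRH` — **Nicolas's (2.18) from RH alone**: for `x ≥ 599`,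
  `−(β+2.042)/(√x log x) + (2.042−β)/(√x log² x) − (8.168+4β)/(√x log³ x) − log(2π)/(x log x)
   − 2/(x^{2/3} log x) − log³ x/(64π² x) ≤ log f(x)`
  (the factor `1.021` multiplies `F_{1/2} ≤ 2/(√x log x) − 2/(√x log² x) + 8/(√x log³ x)`; otherwise the
  assembly of `Nicolas2012_logf_lower_sharp_of_lemma24` verbatim).

The sibling `RobinAnalyticRH.lean` threads the shift `0.042/(√x log x)` (about `2 %` of the leading
term, a fifth of the slack of the worst certified cell of `RobinAnalyticSharp.lean`) through Robin's
argument. Computational dependencies: those of `Schoenfeld1976_theta_holds` (the certified `2000` zeros,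
`native_decide`) and the kernel computations of the tree.

## References

* J.-L. Nicolas, *Small values of the Euler function and the Riemann hypothesis*, Acta Arith. 155
  (2012), 311–321 (arXiv:1202.0729): Lemma 2.4 (2.12) and its proof (Cases 1–3), Cor. 2.1 (2.13),
  display (2.18). [Nicolas2012]
* L. Schoenfeld, Math. Comp. 30 (1976), 337–360, Thm. 10 (6.3). [Schoenfeld1976]
* D. J. Platt, T. S. Trudgian, Math. Comp. 85 (2016), 1539–1547, Thm. 1 (the computation that is
  no longer used). [PlattTrudgian2016Theta]
-/

noncomputable section

open Filter Set MeasureTheory Topology intervalIntegral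
open scoped Real Chebyshev

namespace Literature.NumberTheory.LFunctions

namespace Lemma24RH

open NicolasPsiTheta SchoenfeldMid

/-! ### Case 2 of Lemma 2.4 from Schoenfeld's bound: `2³² ≤ t ≤ 2¹⁰⁰` -/

/-- `t^{1/k} ≤ c·t^{1/3}` for `t ≥ 2³²` as soon as `(2³²)^{1/k − 1/3} ≤ c` (certified through
`(2³²)³ ≤ c^{3k}(2³²)^k`). [folklore] -/
theorem rpow_le_mul_third {t : ℝ} (ht : (2 : ℝ) ^ 32 ≤ t) {k : ℕ} (hk : 4 ≤ k) {c : ℝ} (hc : 0 < c)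
    (h : ((2 : ℝ) ^ 32) ^ 3 ≤ c ^ (3 * k) * ((2 : ℝ) ^ 32) ^ k) :
    t ^ ((1 : ℝ) / k) ≤ c * t ^ ((1 : ℝ) / 3) := by
  have hb : (0 : ℝ) < (2 : ℝ) ^ 32 := by positivity
  have ht0 : 0 < t := hb.trans_le ht
  have hck := rpow_le_of_pow_le (J := 32) (k := k) (by omega) hc h
  have hexp := exp_nonpos hk
  have h1 : t ^ ((1 : ℝ) / k - 1 / 3) ≤ ((2 : ℝ) ^ 32) ^ ((1 : ℝ) / k - 1 / 3) :=
    Real.rpow_le_rpow_of_nonpos hb ht hexp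
  have e : t ^ ((1 : ℝ) / k) = t ^ ((1 : ℝ) / 3) * t ^ ((1 : ℝ) / k - 1 / 3) := by
    rw [← Real.rpow_add ht0]; congr 1; ring
  rw [e, mul_comm c]
  exact mul_le_mul_of_nonneg_left (h1.trans hck) (by positivity)

/-- `log 2³² ≤ 22.1807098`. [folklore] -/
theorem log_two_pow_32_le : Real.log ((2 : ℝ) ^ 32) ≤ 22.1807098 := by
  rw [Real.log_pow]; have := Real.log_two_lt_d9; push_cast; linarith

/-- `22.18 ≤ log 2³²`. [folklore] -/
theorem log_two_pow_32_ge : (22.18 : ℝ) ≤ Real.log ((2 : ℝ) ^ 32) := by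
  rw [Real.log_pow]; have := Real.log_two_gt_d9; push_cast; linarith

/-- **Schoenfeld's excess at `√t`**: `t^{1/4} log² t/(32π) ≤ 0.01912 √t` for `t ≥ 2³²`
(`log² t/t^{1/4}` is non-increasing from `log t ≥ 8`, and `(32 log 2)²/2⁸/(32π) = 0.019117`).
[cite: Nicolas2012, Lemma 2.4, proof (Case 3 method, moved down to `2³²`)] -/
theorem excess_half_le {t : ℝ} (ht : (2 : ℝ) ^ 32 ≤ t) :
    t ^ ((1 : ℝ) / 4) * Real.log t ^ 2 / (32 * π) ≤ 0.01912 * t ^ ((1 : ℝ) / 2) := by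
  have hb : (0 : ℝ) < (2 : ℝ) ^ 32 := by positivity
  have ht0 : 0 < t := hb.trans_le ht
  have hπ := Real.pi_gt_d6
  have hmono := log_pow_div_rpow_le (a := 1 / 4) (by norm_num) (k := 2) (by norm_num) hb
    (by linarith [log_two_pow_32_ge]) ht
  have hb4 : ((2 : ℝ) ^ 32) ^ ((1 : ℝ) / 4) = 256 := by
    rw [← Real.rpow_natCast 2 32, ← Real.rpow_mul (by norm_num)]; norm_num
  rw [hb4] at hmono
  have hL := log_two_pow_32_le
  have hL0 : 0 ≤ Real.log ((2 : ℝ) ^ 32) := Real.log_nonneg (by norm_num)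
  have hsq : Real.log ((2 : ℝ) ^ 32) ^ 2 ≤ 22.1807098 ^ 2 := pow_le_pow_left₀ hL0 hL 2
  have hnum : Real.log ((2 : ℝ) ^ 32) ^ 2 / 256 ≤ 1.9218122 := by
    rw [div_le_iff₀ (by norm_num)]; norm_num at hsq ⊢; linarith
  have hq : Real.log t ^ 2 / t ^ ((1 : ℝ) / 4) ≤ 1.9218122 := hmono.trans hnum
  have ht4 : 0 < t ^ ((1 : ℝ) / 4) := Real.rpow_pos_of_pos ht0 _
  rw [div_le_iff₀ ht4] at hq
  have e : t ^ ((1 : ℝ) / 2) = t ^ ((1 : ℝ) / 4) * t ^ ((1 : ℝ) / 4) := by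
    rw [← Real.rpow_add ht0]; norm_num
  rw [div_le_iff₀ (by positivity), e]
  nlinarith [mul_le_mul_of_nonneg_left hq ht4.le]

/-- `log² t/(72π) · t^{1/6} ≤ 0.054 t^{1/3}` for `t ≥ 2³²` (`log² t/t^{1/6}` non-increasing from
`log t ≥ 12`; `(2³²)^{1/6} ≥ 40.317`). [folklore] -/
theorem excess_third_le {t : ℝ} (ht : (2 : ℝ) ^ 32 ≤ t) :
    t ^ ((1 : ℝ) / 6) * Real.log t ^ 2 / (72 * π) ≤ 0.054 * t ^ ((1 : ℝ) / 3) := by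
  have hb : (0 : ℝ) < (2 : ℝ) ^ 32 := by positivity
  have ht0 : 0 < t := hb.trans_le ht
  have hπ := Real.pi_gt_d6
  have hmono := log_pow_div_rpow_le (a := 1 / 6) (by norm_num) (k := 2) (by norm_num) hb
    (by linarith [log_two_pow_32_ge]) ht
  have hb6 : (40.317 : ℝ) ≤ ((2 : ℝ) ^ 32) ^ ((1 : ℝ) / 6) :=
    le_rpow_of_pow_le (by norm_num) (by norm_num)
  have hL := log_two_pow_32_le
  have hL0 : 0 ≤ Real.log ((2 : ℝ) ^ 32) := Real.log_nonneg (by norm_num)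
  have hsq : Real.log ((2 : ℝ) ^ 32) ^ 2 ≤ 22.1807098 ^ 2 := pow_le_pow_left₀ hL0 hL 2
  have hnum : Real.log ((2 : ℝ) ^ 32) ^ 2 / ((2 : ℝ) ^ 32) ^ ((1 : ℝ) / 6) ≤ 12.203 := by
    rw [div_le_iff₀ (by positivity)]; norm_num at hsq ⊢; nlinarith [hb6]
  have hq : Real.log t ^ 2 / t ^ ((1 : ℝ) / 6) ≤ 12.203 := hmono.trans hnum
  have ht6 : 0 < t ^ ((1 : ℝ) / 6) := Real.rpow_pos_of_pos ht0 _
  rw [div_le_iff₀ ht6] at hq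
  have e : t ^ ((1 : ℝ) / 3) = t ^ ((1 : ℝ) / 6) * t ^ ((1 : ℝ) / 6) := by
    rw [← Real.rpow_add ht0]; norm_num
  rw [div_le_iff₀ (by positivity), e]
  nlinarith [mul_le_mul_of_nonneg_left hq ht6.le]

/-- **Lemma 2.4, Case 2, from RH alone**: for `2³² ≤ t ≤ 2¹⁰⁰`,
`ψ(t) − θ(t) ≤ 1.021 √t + (4/3) t^{1/3}`. From `ψ − θ ≤ ψ(√t) + ψ(t^{1/3}) + ψ(t^{1/5})` (Mathlib),
`ψ(y) − θ(y) ≤ 1.04(√y + y^{1/3} + y^{1/5})` and `θ(y) ≤ y + √y log² y/(8π)` under RH (the tree's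
`Schoenfeld1976_theta_holds`, at `y = √t, t^{1/3} ≥ 599`): the excess over `√t + (4/3)t^{1/3}` is
`≤ 0.01912 √t + (0.054 + 1.04·0.27474 − 1/3) t^{1/3} ≤ 0.0193 √t`. (Nicolas uses `θ(y) < y`,
`y ≤ 8·10¹¹` (Dusart), here replaced by Schoenfeld's bound at the price `0.021 √t`.)
[cite: Nicolas2012, Lemma 2.4 (2.12), proof, Case 2 (modified)] -/
theorem psi_sub_theta_le_case2RH (hRH : RiemannHypothesis) {t : ℝ} (ht : (2 : ℝ) ^ 32 ≤ t) :
    ψ t - θ t ≤ 1.021 * Real.sqrt t + 4 / 3 * t ^ ((1 : ℝ) / 3) := by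
  have hb : (0 : ℝ) < (2 : ℝ) ^ 32 := by positivity
  have ht0 : 0 < t := hb.trans_le ht
  have ht1 : 1 ≤ t := le_trans (by norm_num) ht
  have hS := Schoenfeld1976_theta_holds hRH
  -- the three arguments `y₂ = √t = t^{1/2}`, `y₃ = t^{1/3}`, `y₅ = t^{1/5}`
  have h := Chebyshev.psi_sub_theta_le_psi_add_psi_add_psi t
  have e2 : t ^ ((2 : ℝ)⁻¹) = t ^ ((1 : ℝ) / 2) := by norm_num
  have e3 : t ^ ((3 : ℝ)⁻¹) = t ^ ((1 : ℝ) / 3) := by norm_num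
  have e5 : t ^ ((5 : ℝ)⁻¹) = t ^ ((1 : ℝ) / 5) := by norm_num
  rw [e2, e3, e5] at h
  have hsqrt : Real.sqrt t = t ^ ((1 : ℝ) / 2) := Real.sqrt_eq_rpow t
  -- roots of roots
  have r22 : Real.sqrt (t ^ ((1 : ℝ) / 2)) = t ^ ((1 : ℝ) / 4) := by
    rw [Real.sqrt_eq_rpow, ← Real.rpow_mul ht0.le]; norm_num
  have r23 : (t ^ ((1 : ℝ) / 2)) ^ ((1 : ℝ) / 3) = t ^ ((1 : ℝ) / 6) := by
    rw [← Real.rpow_mul ht0.le]; norm_num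
  have r25 : (t ^ ((1 : ℝ) / 2)) ^ ((1 : ℝ) / 5) = t ^ ((1 : ℝ) / 10) := by
    rw [← Real.rpow_mul ht0.le]; norm_num
  have r32 : Real.sqrt (t ^ ((1 : ℝ) / 3)) = t ^ ((1 : ℝ) / 6) := by
    rw [Real.sqrt_eq_rpow, ← Real.rpow_mul ht0.le]; norm_num
  have r33 : (t ^ ((1 : ℝ) / 3)) ^ ((1 : ℝ) / 3) = t ^ ((1 : ℝ) / 9) := by
    rw [← Real.rpow_mul ht0.le]; norm_num
  have r35 : (t ^ ((1 : ℝ) / 3)) ^ ((1 : ℝ) / 5) = t ^ ((1 : ℝ) / 15) := by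
    rw [← Real.rpow_mul ht0.le]; norm_num
  have l2 : Real.log (t ^ ((1 : ℝ) / 2)) = 1 / 2 * Real.log t := Real.log_rpow ht0 _
  have l3 : Real.log (t ^ ((1 : ℝ) / 3)) = 1 / 3 * Real.log t := Real.log_rpow ht0 _
  -- `√t, t^{1/3} ≥ 599`
  have h599_2 : (599 : ℝ) ≤ t ^ ((1 : ℝ) / 2) :=
    (le_rpow_of_pow_le (J := 32) (n := 2) (by norm_num) (by norm_num)).trans
      (Real.rpow_le_rpow hb.le ht (by norm_num))
  have h599_3 : (599 : ℝ) ≤ t ^ ((1 : ℝ) / 3) :=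
    (le_rpow_of_pow_le (J := 32) (n := 3) (by norm_num) (by norm_num)).trans
      (Real.rpow_le_rpow hb.le ht (by norm_num))
  -- Schoenfeld and `ψ − θ ≤ 1.04(…)` at `√t` and `t^{1/3}`; `ψ ≤ 1.04 y` at `t^{1/5}`
  have hθ2 := (abs_le.1 (hS _ h599_2)).2
  have hθ3 := (abs_le.1 (hS _ h599_3)).2
  rw [r22, l2] at hθ2
  rw [r32, l3] at hθ3
  have hψ2 := SchoenfeldBound.psi_sub_theta_le hRH (x := t ^ ((1 : ℝ) / 2)) (by positivity)
  have hψ3 := SchoenfeldBound.psi_sub_theta_le hRH (x := t ^ ((1 : ℝ) / 3)) (by positivity)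
  rw [r22, r23, r25] at hψ2
  rw [r32, r33, r35] at hψ3
  have hψ5 := SchoenfeldBound.psi_le_mul hRH (y := t ^ ((1 : ℝ) / 5)) (by positivity)
  -- the two logarithmic excesses
  have hA := excess_half_le ht
  have hB := excess_third_le ht
  have eA : t ^ ((1 : ℝ) / 4) * (1 / 2 * Real.log t) ^ 2 / (8 * π) =
      t ^ ((1 : ℝ) / 4) * Real.log t ^ 2 / (32 * π) := by ring
  have eB : t ^ ((1 : ℝ) / 6) * (1 / 3 * Real.log t) ^ 2 / (8 * π) =
      t ^ ((1 : ℝ) / 6) * Real.log t ^ 2 / (72 * π) := by ring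
  rw [eA] at hθ2
  rw [eB] at hθ3
  -- fractional powers below `t^{1/3}`
  have h4 := rpow_le_mul_third ht (k := 4) (by norm_num) (c := 0.1575) (by norm_num) (by norm_num)
  have h6 := rpow_le_mul_third ht (k := 6) (by norm_num) (c := 0.02481) (by norm_num) (by norm_num)
  have h5 := rpow_le_mul_third ht (k := 5) (by norm_num) (c := 0.052) (by norm_num) (by norm_num)
  have h9 := rpow_le_mul_third ht (k := 9) (by norm_num) (c := 0.00724) (by norm_num) (by norm_num)
  have h10 := rpow_le_mul_third ht (k := 10) (by norm_num) (c := 0.00566) (by norm_num) (by norm_num)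
  have h15 := rpow_le_mul_third ht (k := 15) (by norm_num) (c := 0.00272) (by norm_num) (by norm_num)
  simp only [Nat.cast_ofNat] at h4 h6 h5 h9 h10 h15
  -- `t^{1/3} ≤ 0.02481 √t`
  have h36 : t ^ ((1 : ℝ) / 3) ≤ 0.02481 * t ^ ((1 : ℝ) / 2) := by
    have h1 : t ^ ((1 : ℝ) / 3 - 1 / 2) ≤ ((2 : ℝ) ^ 32) ^ ((1 : ℝ) / 3 - 1 / 2) :=
      Real.rpow_le_rpow_of_nonpos hb ht (by norm_num)
    have h2 : ((2 : ℝ) ^ 32) ^ ((1 : ℝ) / 3 - 1 / 2) ≤ 0.02481 := by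
      have := rpow_le_of_pow_le (J := 32) (k := 6) (by norm_num) (c := 0.02481) (by norm_num)
        (by norm_num)
      convert this using 2; norm_num
    have e : t ^ ((1 : ℝ) / 3) = t ^ ((1 : ℝ) / 2) * t ^ ((1 : ℝ) / 3 - 1 / 2) := by
      rw [← Real.rpow_add ht0]; norm_num
    rw [e, mul_comm (0.02481 : ℝ)]
    exact mul_le_mul_of_nonneg_left (h1.trans h2) (by positivity)
  have ht3 : 0 ≤ t ^ ((1 : ℝ) / 3) := by positivity
  rw [hsqrt]
  nlinarith [h, hθ2, hθ3, hψ2, hψ3, hψ5, hA, hB, h4, h6, h5, h9, h10, h15, h36, ht3]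

/-- **Nicolas 2012, Lemma 2.4 (2.12) weakened by `2.1 %` on `√x`, under RH alone**: for `x ≥ 1`,
`ψ(x) − θ(x) ≤ 1.021 √x + (4/3) x^{1/3}`. Case 1 (`x < 2³²`) is the tree's kernel computation
`psi_sub_theta_le_of_lt_two_pow_32`, Case 3 (`x ≥ 2¹⁰⁰`) is `NicolasPsiTheta.psi_sub_theta_le_case3`
with `Schoenfeld1976_theta_holds`, Case 2 is `psi_sub_theta_le_case2RH`; no `θ(y) < y` table enters.
[cite: Nicolas2012, Lemma 2.4 (2.12) (modified constant)] -/
theorem psi_sub_theta_le (hRH : RiemannHypothesis) {x : ℝ} (hx : 1 ≤ x) :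
    ψ x - θ x ≤ 1.021 * Real.sqrt x + 4 / 3 * x ^ ((1 : ℝ) / 3) := by
  have hs := Real.sqrt_nonneg x
  rcases lt_or_ge x ((2 : ℝ) ^ 32) with h32 | h32
  · have := psi_sub_theta_le_of_lt_two_pow_32 hx h32
    linarith
  rcases le_or_gt x ((2 : ℝ) ^ 100) with h100 | h100
  · exact psi_sub_theta_le_case2RH hRH h32
  · have := NicolasPsiTheta.psi_sub_theta_le_case3 hRH Schoenfeld1976_theta_holds h100.le
    linarith

end Lemma24RH

/-! ### Corollary 2.1 and (2.18) with the weakened Lemma 2.4 -/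

namespace Lemma24RH

open NicolasJ NicolasFz NicolasK NicolasJExplicit

/-- **Cor. 2.1 (2.13), upper half, with the factor `1.021`**: if
`ψ(t) − θ(t) ≤ 1.021√t + (4/3)t^{1/3}` and `|ψ₁(t) − t²/2| ≤ C t^{3/2}` for `t ≥ x > 1`, then
`J(x) − K(x) ≤ 1.021 F_{1/2}(x) + (4/3) F_{1/3}(x)` (the proof of `NicolasK.cor21_upper` verbatim).
[cite: Nicolas2012, Cor. 2.1 (2.13) (modified constant)] -/
theorem cor21_upperRH {x C : ℝ} (hx : 1 < x)
    (hR : ∀ t, x ≤ t → |Rone t| ≤ C * t ^ (3 / 2 : ℝ))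
    (hψθ : ∀ t, x ≤ t → ψ t - θ t ≤ 1.021 * Real.sqrt t + 4 / 3 * t ^ ((1 : ℝ) / 3)) :
    nicolasJ x - nicolasKInt x ≤ 1.021 * (Fz (1 / 2 : ℝ) x).re + 4 / 3 * (Fz (1 / 3 : ℝ) x).re := by
  have hlim := (tendsto_integral_R_mul_w0 hx hR).sub (tendsto_integral_S_mul_w0 hx)
  refine le_of_tendsto hlim ?_
  filter_upwards [eventually_ge_atTop x] with X hX
  have hiψ := intervalIntegrable_R_mul_w0 hx hX
  have hiθ := intervalIntegrable_S_mul_w0 hx hX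
  have hi2 := intervalIntegrable_rpow_mul_w0 (1 / 2) hx hX
  have hi3 := intervalIntegrable_rpow_mul_w0 (1 / 3) hx hX
  rw [← intervalIntegral.integral_sub hiψ hiθ]
  have hsimp : ∫ t in x..X, ((ψ t - t) * w0 t - (θ t - t) * w0 t) =
      ∫ t in x..X, (ψ t - θ t) * w0 t :=
    intervalIntegral.integral_congr fun t _ ↦ by ring
  rw [hsimp]
  have hmono : ∫ t in x..X, (ψ t - θ t) * w0 t ≤
      ∫ t in x..X, (1.021 * (t ^ (1 / 2 : ℝ) * w0 t) + 4 / 3 * (t ^ ((1 : ℝ) / 3) * w0 t)) := by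
    refine intervalIntegral.integral_mono_on hX (hiψ.sub hiθ |>.congr ?_)
      ((hi2.const_mul _).add (hi3.const_mul _)) fun t ht ↦ ?_
    · exact fun t _ ↦ by ring
    · have ht1 : 1 < t := hx.trans_le ht.1
      have h := hψθ t ht.1
      rw [Real.sqrt_eq_rpow] at h
      have hw := (w0_pos ht1).le
      calc (ψ t - θ t) * w0 t ≤ (1.021 * t ^ (1 / 2 : ℝ) + 4 / 3 * t ^ ((1 : ℝ) / 3)) * w0 t :=
            mul_le_mul_of_nonneg_right h hw
        _ = _ := by ring
  refine hmono.trans ?_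
  rw [intervalIntegral.integral_add (hi2.const_mul _) (hi3.const_mul _),
    intervalIntegral.integral_const_mul, intervalIntegral.integral_const_mul]
  have h2 := integral_rpow_mul_w0_le_Fz (a := 1 / 2) (by norm_num) hx hX
  have h3 := integral_rpow_mul_w0_le_Fz (a := (1 : ℝ) / 3) (by norm_num) hx hX
  have h3' : 4 / 3 * ∫ t in x..X, t ^ ((1 : ℝ) / 3) * w0 t ≤ 4 / 3 * (Fz (1 / 3 : ℝ) x).re := by
    rw [show ((1 : ℝ) / 3) = (1 / 3 : ℝ) by norm_num] at h3 ⊢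
    linarith
  linarith

/-- **Nicolas's (2.18) with the weakened Lemma 2.4, from RH alone**: under RH, for `x ≥ 599`,
`−(β+2.042)/(√x log x) + (2.042−β)/(√x log² x) − (8.168+4β)/(√x log³ x) − log(2π)/(x log x)
 − 2/(x^{2/3} log x) − log³ x/(64π² x) ≤ log f(x)` — the assembly of
`Nicolas2012_logf_lower_sharp_of_lemma24` with `cor21_upperRH` in place of Cor. 2.1: the factor `1.021`
multiplies the bound `F_{1/2} ≤ 2/(√x log x) − 2/(√x log² x) + 8/(√x log³ x)`. Everything used is
proved in the tree: Schoenfeld's `θ`-bound (`Schoenfeld1976_theta_holds`), Lemma 2.1, the explicit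
formula for `J`, `F_{1/2}`, `F_{1/3}`, and the Case-1 computation below `2³²`.
[cite: Nicolas2012, (2.18) (proof of Prop. 2.1) (modified constants)] -/
theorem logf_lowerRH (hRH : RiemannHypothesis) {x : ℝ} (hx : 599 ≤ x) :
    -(nicolasBeta + 2.042) / (√x * Real.log x) + (2.042 - nicolasBeta) / (√x * Real.log x ^ 2)
        - (8.168 + 4 * nicolasBeta) / (√x * Real.log x ^ 3) - Real.log (2 * π) / (x * Real.log x)
        - 2 / (x ^ ((2 : ℝ) / 3) * Real.log x) - Real.log x ^ 3 / (64 * π ^ 2 * x)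
      ≤ Real.log (nicolasF x) := by
  have hS := Schoenfeld1976_theta_holds
  have hx1 : (1 : ℝ) < x := by linarith
  obtain ⟨C, hC⟩ := NicolasJExplicit.exists_abs_Rone_le_of_RH hRH
  have hR : ∀ t, x ≤ t → |NicolasJ.Rone t| ≤ C * t ^ (3 / 2 : ℝ) := fun t ht ↦ hC t (by linarith)
  have hψθ : ∀ t, x ≤ t → ψ t - θ t ≤ 1.021 * Real.sqrt t + 4 / 3 * t ^ ((1 : ℝ) / 3) :=
    fun t ht ↦ psi_sub_theta_le hRH (by linarith)
  have h21 := NicolasK.lemma21_lower (by linarith : (121 : ℝ) ≤ x)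
    (Nicolas2012Sharp.theta_ge_four_fifths hS hRH hx)
  have h213 := cor21_upperRH hx1 hR hψθ
  have hJ := NicolasJExplicit.nicolasJ_ge_of_RH hRH hx1
  have hF2 := NicolasFz.Fhalf_le hx1
  have hF20 : 0 ≤ (Fz (1 / 2 : ℝ) x).re := NicolasFz.Fz_re_nonneg hx1
  have hF3 := NicolasFz.Fthird_le hx1
  have hS2 := Nicolas2012Sharp.sq_theta_sub_div_le hS hRH hx
  obtain ⟨a₁, ha₁⟩ : ∃ a : ℝ, a = 1 / (Real.sqrt x * Real.log x) := ⟨_, rfl⟩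
  obtain ⟨a₂, ha₂⟩ : ∃ a : ℝ, a = 1 / (Real.sqrt x * Real.log x ^ 2) := ⟨_, rfl⟩
  obtain ⟨a₃, ha₃⟩ : ∃ a : ℝ, a = 1 / (Real.sqrt x * Real.log x ^ 3) := ⟨_, rfl⟩
  obtain ⟨a₅, ha₅⟩ : ∃ a : ℝ, a = 1 / (x ^ ((2 : ℝ) / 3) * Real.log x) := ⟨_, rfl⟩
  have eJ : -nicolasBeta / (Real.sqrt x * Real.log x)
      - nicolasBeta * ((1 + 4 / Real.log x) / (Real.sqrt x * Real.log x ^ 2))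
      - Real.log (2 * π) / (x * Real.log x) =
      -nicolasBeta * a₁ - nicolasBeta * a₂ - 4 * nicolasBeta * a₃ - Real.log (2 * π) / (x * Real.log x) := by
    rw [ha₁, ha₂, ha₃]; ring
  have eF2 : 2 / (Real.sqrt x * Real.log x) - 2 / (Real.sqrt x * Real.log x ^ 2) +
      8 / (Real.sqrt x * Real.log x ^ 3) = 2 * a₁ - 2 * a₂ + 8 * a₃ := by
    rw [ha₁, ha₂, ha₃]; ring
  have eF3 : 3 / (2 * x ^ (2 / 3 : ℝ) * Real.log x) = 3 / 2 * a₅ := by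
    rw [ha₅]; ring
  have eT : -(nicolasBeta + 2.042) / (√x * Real.log x) + (2.042 - nicolasBeta) / (√x * Real.log x ^ 2)
      - (8.168 + 4 * nicolasBeta) / (√x * Real.log x ^ 3) - Real.log (2 * π) / (x * Real.log x)
      - 2 / (x ^ ((2 : ℝ) / 3) * Real.log x) - Real.log x ^ 3 / (64 * π ^ 2 * x) =
      -(nicolasBeta + 2.042) * a₁ + (2.042 - nicolasBeta) * a₂ - (8.168 + 4 * nicolasBeta) * a₃
      - Real.log (2 * π) / (x * Real.log x) - 2 * a₅ - Real.log x ^ 3 / (64 * π ^ 2 * x) := by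
    rw [ha₁, ha₂, ha₃, ha₅]; ring
  rw [eT]
  rw [eJ] at hJ
  rw [eF2] at hF2
  rw [eF3] at hF3
  have hF2' : 1.021 * (Fz (1 / 2 : ℝ) x).re ≤ 1.021 * (2 * a₁ - 2 * a₂ + 8 * a₃) :=
    mul_le_mul_of_nonneg_left hF2 (by norm_num)
  linarith

end Lemma24RH

end Literature.NumberTheory.LFunctions

end
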